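import Summits.QuantumFields.BalabanUV.Beta.D1BFx.TorusWeightMixedTermW4
import Summits.QuantumFields.BalabanUV.Beta.D1BFx.TorusWeightJetsTwisted

/-!
# TB4-W PART 3b-N (FILE N3d) — THE MIXED STRAIGHT WEIGHT JET `2•wgtMix` AS ONE PERIODISED BOND ARRAY (road «BF-x», slot (K); ρ-g7-8, (S1))

Assembly of FILES N3a–N3c: with `W₁ = W₉ᵀ`, `W₂ = −W₈ᵀ`, `W₃ = −W₇ᵀ`, `W₆ = W₅ᵀ` (3a′ `transpose_Chat`, `transpose_Cjet₁`) and `((arr K)^)ᵀ = (arr (trK K))^`,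
**`2 • wgtMix s b b′ N = (arr s (BwMix s (m+1) a κ u l u′))^`** at the torus images `b = (σu,κ)`, `b′ = (σu′,l)` of two `ℤ⁴` bonds, for EVERY
`s = (m+1)p` and every basis `N` of `ker Ŝ` (3a's `hN`, `hNinj`), where [our object]
`BwMix s n a κ u l u′ := 2 • (trK K9 − trK K8 − trK K7 + K4 + K5 + trK K5 + K7 + K8 + K9)` (`K8 := K7` with the bonds exchanged) is an
EXPLICIT s-DEPENDENT `ℤ⁴` bond kernel (shape (S1) of ruling ρ-g7-8: one-array kernels, two-array kernels `X ∘ A ∘ arr s Y`, the two-`Ê` table, the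
torus test).  Also: `Loc (BwMix …)` for every `s` (the uniform constants (u1) and the entrywise limits (u2) are FILE N3e).
[folklore]; the definition asserts nothing.
-/

noncomputable section

namespace Summit.QuantumFields.BalabanUV.Beta.D1BFx.TorusWeightMixedArrays

open Matrix
open scoped BigOperators
open Literature.MathematicalPhysics.QuantumFieldTheory.Balaban1983to89
open Literature.MathematicalPhysics.QuantumFieldTheory.Balaban1983to89.Beta
open ExpKernelCalculus (MKer BiLoc)
open Summit.QuantumFields.BalabanUV.Beta.TameKernelCalculus (Loc trK)
open Summit.QuantumFields.BalabanUV.Beta.D1BFx.PeriodicArrays (arr toF)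
open Summit.QuantumFields.BalabanUV.Beta.D1BFx.FibredPeriodisation (periodiseF)
open Summit.QuantumFields.BalabanUV.Beta.D1BFx.PeriodisedProjector (Shat)
open Summit.QuantumFields.BalabanUV.Beta.D1BFx.TorusCoframeJets (Mjet₀ Mjet₁ Mjet₁₁)
open Summit.QuantumFields.BalabanUV.Beta.D1BFx.TorusWeightJetsCombFree (Chat Cjet₁ Cjet₁₁ wgtMix)
open Summit.QuantumFields.BalabanUV.Beta.D1BFx.TorusWeightJetsTwisted (transpose_Chat transpose_Cjet₁)
open Summit.QuantumFields.BalabanUV.Beta.D1BFx.TorusBondArrays (hat_arr_neg hat_arr_smul)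
open Summit.QuantumFields.BalabanUV.Beta.D1BFx.TorusMixedLetters (hat_arr_add_loc hat_arr_sub_loc transpose_hat_arr)
open Summit.QuantumFields.BalabanUV.Beta.D1BFx.TorusWeightMixedTerms (K5 K7 K9 K4 W5_eq_hat W7_eq_hat W9_eq_hat loc_K5 loc_K7 loc_K9)
open Summit.QuantumFields.BalabanUV.Beta.D1BFx.TorusWeightMixedTermW4 (W4_eq_hat loc_K4)

/-! ## §1 The kernel -/

section Kernel

variable (s : ℕ) [NeZero s] (n : ℕ) [NeZero n] (a : ℝ) (κ : Fin 4) (u : Fin 4 → ℤ) (l : Fin 4) (u' : Fin 4 → ℤ)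

/-- [our object] **THE BOND TABLE OF `2•wgtMix`** (nine terms of 3a in the order `W₁ … W₉`):
`2 • (trK K9 − trK K8 − trK K7 + K4 + K5 + trK K5 + K7 + K8 + K9)`, `K8 = K7` with the bonds exchanged. A definition; asserts nothing. -/
def BwMix : MKer 4 (Fin 4) :=
  (2 : ℝ) • (trK (K9 s n a κ u l u') - trK (K7 s n a l u' κ u) - trK (K7 s n a κ u l u') + K4 s n a κ u l u' + K5 s n a κ u l u'
    + trK (K5 s n a κ u l u') + K7 s n a κ u l u' + K7 s n a l u' κ u + K9 s n a κ u l u')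

end Kernel

/-! ## §2 The identity -/

section Identity

variable (m : ℕ) {a : ℝ} (p : ℕ) [NeZero p] {ρ : Type*} [Fintype ρ] [DecidableEq ρ] (κ : Fin 4) (u : Fin 4 → ℤ) (l : Fin 4) (u' : Fin 4 → ℤ)

/-- [folklore] `Loc (BwMix s (m+1) a κ u l u′)` for every `s = (m+1)p`. -/
theorem loc_BwMix (ha : 0 < a) : Loc (BwMix ((m + 1) * p) (m + 1) a κ u l u') := by
  have h5 := loc_K5 m p κ u l u' ha
  have h7 := loc_K7 m p κ u l u' ha
  have h8 := loc_K7 m p l u' κ u ha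
  have h9 := loc_K9 m p κ u l u' ha
  have h4 := loc_K4 m p κ u l u' ha
  exact ((((((((h9.trK.sub h8.trK).sub h7.trK).add h4).add h5).add h5.trK).add h7).add h8).add h9).smul 2

/-- [folklore] **`2•wgtMix = (arr BwMix)^`**: twice the mixed straight weight jet of 3a at the torus bonds `(σu,κ)`, `(σu′,l)`, over any basis `N` of
`ker Ŝ`, is the bond-fibred periodisation of TA2's array of the explicit s-dependent `ℤ⁴` kernel `BwMix` — the `ℬ₂` slot of K-END-RECUT §2 in the
shape (S1) of ruling ρ-g7-8 (exact for every torus of the road's family). -/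
theorem two_smul_wgtMix_eq_hat (ha : 0 < a) {N : Matrix (Site 4 ((m + 1) * p)) ρ ℝ}
    (hN : ∀ lam : Site 4 ((m + 1) * p) → ℝ, Shat m ((m + 1) * p) *ᵥ lam = 0 ↔ ∃ c : ρ → ℝ, lam = N *ᵥ c)
    (hNinj : Function.Injective N.mulVec) :
    (2 : ℝ) • wgtMix ((m + 1) * p) (siteOf 4 ((m + 1) * p) u, κ) (siteOf 4 ((m + 1) * p) u', l) N = Matrix.of (periodiseF ((m + 1) * p) (toF (arr ((m + 1) * p) (BwMix ((m + 1) * p) (m + 1) a κ u l u')))) := by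
  have L5 := loc_K5 m p κ u l u' ha
  have L7 := loc_K7 m p κ u l u' ha
  have L8 := loc_K7 m p l u' κ u ha
  have L9 := loc_K9 m p κ u l u' ha
  have L4 := loc_K4 m p κ u l u' ha
  have h5 := W5_eq_hat m p κ u l u' ha hN hNinj
  have h7 := W7_eq_hat m p κ u l u' ha hN hNinj
  have h8 := W7_eq_hat m p l u' κ u ha hN hNinj
  have h9 := W9_eq_hat m p κ u l u' ha hN hNinj
  have h4 := W4_eq_hat m p κ u l u' ha hN hNinj
  -- the four transposed words
  have h1 : (Mjet₁₁ ((m + 1) * p) (siteOf 4 ((m + 1) * p) u, κ) (siteOf 4 ((m + 1) * p) u', l))ᵀ * Chat ((m + 1) * p) N * Mjet₀ ((m + 1) * p) = Matrix.of (periodiseF ((m + 1) * p) (toF (arr ((m + 1) * p) (trK (K9 ((m + 1) * p) (m + 1) a κ u l u'))))) := by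
    rw [show (Mjet₁₁ ((m + 1) * p) (siteOf 4 ((m + 1) * p) u, κ) (siteOf 4 ((m + 1) * p) u', l))ᵀ * Chat ((m + 1) * p) N * Mjet₀ ((m + 1) * p) = ((Mjet₀ ((m + 1) * p))ᵀ * Chat ((m + 1) * p) N * Mjet₁₁ ((m + 1) * p) (siteOf 4 ((m + 1) * p) u, κ) (siteOf 4 ((m + 1) * p) u', l))ᵀ by
      rw [Matrix.transpose_mul, Matrix.transpose_mul, Matrix.transpose_transpose, transpose_Chat, Matrix.mul_assoc], h9, transpose_hat_arr]
  have h2 : (Mjet₁ ((m + 1) * p) (siteOf 4 ((m + 1) * p) u, κ))ᵀ * Cjet₁ ((m + 1) * p) (siteOf 4 ((m + 1) * p) u', l) N * Mjet₀ ((m + 1) * p) = -Matrix.of (periodiseF ((m + 1) * p) (toF (arr ((m + 1) * p) (trK (K7 ((m + 1) * p) (m + 1) a l u' κ u))))) := by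
    rw [show (Mjet₁ ((m + 1) * p) (siteOf 4 ((m + 1) * p) u, κ))ᵀ * Cjet₁ ((m + 1) * p) (siteOf 4 ((m + 1) * p) u', l) N * Mjet₀ ((m + 1) * p) = -((Mjet₀ ((m + 1) * p))ᵀ * Cjet₁ ((m + 1) * p) (siteOf 4 ((m + 1) * p) u', l) N * Mjet₁ ((m + 1) * p) (siteOf 4 ((m + 1) * p) u, κ))ᵀ by
      rw [Matrix.transpose_mul, Matrix.transpose_mul, Matrix.transpose_transpose, transpose_Cjet₁]
      simp only [Matrix.neg_mul, Matrix.mul_neg, neg_neg, Matrix.mul_assoc], h8, transpose_hat_arr]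
  have h3 : (Mjet₁ ((m + 1) * p) (siteOf 4 ((m + 1) * p) u', l))ᵀ * Cjet₁ ((m + 1) * p) (siteOf 4 ((m + 1) * p) u, κ) N * Mjet₀ ((m + 1) * p) = -Matrix.of (periodiseF ((m + 1) * p) (toF (arr ((m + 1) * p) (trK (K7 ((m + 1) * p) (m + 1) a κ u l u'))))) := by
    rw [show (Mjet₁ ((m + 1) * p) (siteOf 4 ((m + 1) * p) u', l))ᵀ * Cjet₁ ((m + 1) * p) (siteOf 4 ((m + 1) * p) u, κ) N * Mjet₀ ((m + 1) * p) = -((Mjet₀ ((m + 1) * p))ᵀ * Cjet₁ ((m + 1) * p) (siteOf 4 ((m + 1) * p) u, κ) N * Mjet₁ ((m + 1) * p) (siteOf 4 ((m + 1) * p) u', l))ᵀ by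
      rw [Matrix.transpose_mul, Matrix.transpose_mul, Matrix.transpose_transpose, transpose_Cjet₁]
      simp only [Matrix.neg_mul, Matrix.mul_neg, neg_neg, Matrix.mul_assoc], h7, transpose_hat_arr]
  have h6 : (Mjet₁ ((m + 1) * p) (siteOf 4 ((m + 1) * p) u', l))ᵀ * Chat ((m + 1) * p) N * Mjet₁ ((m + 1) * p) (siteOf 4 ((m + 1) * p) u, κ) = Matrix.of (periodiseF ((m + 1) * p) (toF (arr ((m + 1) * p) (trK (K5 ((m + 1) * p) (m + 1) a κ u l u'))))) := by
    rw [show (Mjet₁ ((m + 1) * p) (siteOf 4 ((m + 1) * p) u', l))ᵀ * Chat ((m + 1) * p) N * Mjet₁ ((m + 1) * p) (siteOf 4 ((m + 1) * p) u, κ) = ((Mjet₁ ((m + 1) * p) (siteOf 4 ((m + 1) * p) u, κ))ᵀ * Chat ((m + 1) * p) N * Mjet₁ ((m + 1) * p) (siteOf 4 ((m + 1) * p) u', l))ᵀ by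
      rw [Matrix.transpose_mul, Matrix.transpose_mul, Matrix.transpose_transpose, transpose_Chat, Matrix.mul_assoc], h5, transpose_hat_arr]
  rw [wgtMix, h1, h2, h3, h4, h5, h6, h7, h8, h9, BwMix, hat_arr_smul,
    hat_arr_add_loc _ (((((((L9.trK.sub L8.trK).sub L7.trK).add L4).add L5).add L5.trK).add L7).add L8) L9,
    hat_arr_add_loc _ ((((((L9.trK.sub L8.trK).sub L7.trK).add L4).add L5).add L5.trK).add L7) L8,
    hat_arr_add_loc _ (((((L9.trK.sub L8.trK).sub L7.trK).add L4).add L5).add L5.trK) L7,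
    hat_arr_add_loc _ ((((L9.trK.sub L8.trK).sub L7.trK).add L4).add L5) L5.trK,
    hat_arr_add_loc _ (((L9.trK.sub L8.trK).sub L7.trK).add L4) L5,
    hat_arr_add_loc _ ((L9.trK.sub L8.trK).sub L7.trK) L4,
    hat_arr_sub_loc _ (L9.trK.sub L8.trK) L7.trK, hat_arr_sub_loc _ L9.trK L8.trK]
  simp only [smul_add, smul_neg, sub_eq_add_neg]

end Identity

end Summit.QuantumFields.BalabanUV.Beta.D1BFx.TorusWeightMixedArrays

end
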